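import Literature.AlgebraicGeometry.Motives.SeesawChartCover
import Literature.AlgebraicGeometry.Motives.SeesawChartKernelRepr
import HarnessLib

/-!
# The seesaw closed subscheme over a possibly non-reduced base (Mumford §10, scheme form; Görtz–Wedhorn II Thm. 24.66)

[MumfordAV1970] §10 (p. 89) / [GortzWedhorn2023] Thm. 24.66: for `X/ℂ` proper and geometrically integral with a point `x₀`,
`W/ℂ` locally of finite type and `𝓕` a module of rank one on `X × W`, there is a CLOSED SUBSCHEME `Z ↪ W` such that a
`ℂ`-morphism `u : S → W` (ANY scheme `S/ℂ`) factors through `Z` iff `(1_X × u)^*𝓕 ≅ pr_S^*𝓜` for some rank-one `𝓜` on `S`.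
Assembly of the chain: the global half `SeesawSubschemeGlobal` (glued ideal sheaf + universal property, ALL `S`) over
`N1cLocal` (`SeesawChartCover`: a representing ideal on every affine open, from the chart theorem `SeesawChartAway`,
the charts at every prime `SeesawChartRepr`, the fibres `SeesawChartFibreCyclic`, the representing modules of the
Grothendieck complex `SeesawChartKernelRepr`) and `N1cDelta` (`SeesawTrivFromBaseLocal`).  Two forms: `exists_seesawSubscheme`
(quasi-coherence binders displayed) and `exists_seesawSubscheme'` (a module of constant rank is quasi-coherent,
★ `isQuasicoherent_of_hasRank`).  (Cell `hodgecm-mathlib`, M13 node N1, file S9; HOME certificate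
`B-plan/m13-glue/N1-Assembly.v10.B-p01g12.lean`.)

## References
* [MumfordAV1970] D. Mumford, *Abelian Varieties* (1970), §10 p. 89 (and §5 pp. 46–51).
* [GortzWedhorn2023] U. Görtz, T. Wedhorn, *Algebraic Geometry II* (2023), Thm. 24.66 (p. 405; proof pp. 407–408).
-/

set_option autoImplicit false

noncomputable section

open CategoryTheory CategoryTheory.Limits AlgebraicGeometry MonoidalCategory CartesianMonoidalCategory
open Literature.AlgebraicGeometry.Modules

namespace Literature.AlgebraicGeometry.Motives

namespace SeesawSubscheme

/-- **THE SEESAW CLOSED SUBSCHEME** ([MumfordAV1970] §10 p. 89; [GortzWedhorn2023] Thm. 24.66): for `X/ℂ` proper and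
geometrically integral with a point, `W/ℂ` locally of finite type and `𝓕` quasi-coherent of rank one on `X × W`, there
is a closed subscheme `Z ↪ W` such that ANY `u : S → W` over `ℂ` factors through `Z` iff `(1 × u)^*𝓕 ≅ pr_S^*𝓜` for a
rank-one quasi-coherent `𝓜` on `S`. [cite: MumfordAV1970, §10 (p. 89)]
[cite: GortzWedhorn2023, Thm. 24.66 (p. 405; proof pp. 407–408)] -/
theorem exists_seesawSubscheme
    (X : SchemeOver ℂ) [IsProper X.hom] [GeometricallyIntegral X.hom] (x₀ : 𝟙_ (SchemeOver ℂ) ⟶ X)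
    (W : SchemeOver ℂ) [LocallyOfFiniteType W.hom] (𝓕 : (X ⊗ W).left.Modules) [𝓕.IsQuasicoherent]
    (h𝓕 : HasRank 𝓕 1) :
    ∃ (Z : SchemeOver ℂ) (i : Z ⟶ W) (_ : IsClosedImmersion i.left),
      ∀ (S : SchemeOver ℂ) (u : S ⟶ W),
        (∃ v : S ⟶ Z, v ≫ i = u) ↔
          ∃ (𝓜 : S.left.Modules) (_ : 𝓜.IsQuasicoherent) (_ : HasRank 𝓜 1),
            Nonempty ((Scheme.Modules.pullback (X ◁ u).left).obj 𝓕 ≅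
              (Scheme.Modules.pullback (CartesianMonoidalCategory.snd X S).left).obj 𝓜) :=
  exists_seesawSubscheme_of_repr (fun X _ _ _ _ 𝓕 _ h𝓕 U =>
    ⟨h0Repr_of_kernelRepr X 𝓕 U (h0KernelRepr_holds X 𝓕 U h𝓕),
      dualRepr_of_kernelRepr X 𝓕 U h𝓕 (dualKernelRepr_holds X 𝓕 U h𝓕)⟩) X x₀ W 𝓕 h𝓕

/-- **`N1cLocal` holds**: every affine open of `W` carries a representing ideal (the named statement of
`SeesawSubschemeReprIdeal`, discharged from the per-chart inputs). [cite: MumfordAV1970, §10 (p. 89)] -/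
theorem n1cLocal_holds : N1cLocal :=
  n1cLocal_of_repr (fun X _ _ _ _ 𝓕 _ h𝓕 U =>
    ⟨h0Repr_of_kernelRepr X 𝓕 U (h0KernelRepr_holds X 𝓕 U h𝓕),
      dualRepr_of_kernelRepr X 𝓕 U h𝓕 (dualKernelRepr_holds X 𝓕 U h𝓕)⟩)

/-- **THE SEESAW CLOSED SUBSCHEME, rank-one currency** (no quasi-coherence binders: a module of constant rank is
quasi-coherent, ★ `isQuasicoherent_of_hasRank`). [cite: MumfordAV1970, §10 (p. 89)]
[cite: GortzWedhorn2023, Thm. 24.66 (p. 405; proof pp. 407–408)] -/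
theorem exists_seesawSubscheme'
    (X : SchemeOver ℂ) [IsProper X.hom] [GeometricallyIntegral X.hom] (x₀ : 𝟙_ (SchemeOver ℂ) ⟶ X)
    (W : SchemeOver ℂ) [LocallyOfFiniteType W.hom] (𝓕 : (X ⊗ W).left.Modules) (h𝓕 : HasRank 𝓕 1) :
    ∃ (Z : SchemeOver ℂ) (i : Z ⟶ W) (_ : IsClosedImmersion i.left),
      ∀ (S : SchemeOver ℂ) (u : S ⟶ W),
        (∃ v : S ⟶ Z, v ≫ i = u) ↔
          ∃ (𝓜 : S.left.Modules) (_ : HasRank 𝓜 1),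
            Nonempty ((Scheme.Modules.pullback (X ◁ u).left).obj 𝓕 ≅
              (Scheme.Modules.pullback (CartesianMonoidalCategory.snd X S).left).obj 𝓜) := by
  haveI : 𝓕.IsQuasicoherent := isQuasicoherent_of_hasRank h𝓕
  obtain ⟨Z, i, hi, hZ⟩ := exists_seesawSubscheme X x₀ W 𝓕 h𝓕
  refine ⟨Z, i, hi, fun S u => (hZ S u).trans ⟨?_, ?_⟩⟩
  · rintro ⟨𝓜, -, h1, e⟩
    exact ⟨𝓜, h1, e⟩
  · rintro ⟨𝓜, h1, e⟩
    exact ⟨𝓜, isQuasicoherent_of_hasRank h1, h1, e⟩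

end SeesawSubscheme

end Literature.AlgebraicGeometry.Motives

end
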